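import Literature.MathematicalPhysics.QuantumFieldTheory.Balaban1983to89.B9Thm37WholeDir
import Literature.MathematicalPhysics.QuantumFieldTheory.Balaban1983to89.B9RWSums346MixedPair
import Literature.MathematicalPhysics.QuantumFieldTheory.Balaban1983to89.B9CoReadingCoordsS
import Literature.MathematicalPhysics.QuantumFieldTheory.Balaban1983to89.B9PinMembersKLevelV1
import Literature.MathematicalPhysics.QuantumFieldTheory.Balaban1983to89.B9CoReadingCoordsTranspose

/-!
# `Balaban1983to89.B9DirSupAtPins` — THE DIRECTION-TRANSFER SCHEMAS `DirSup37` ∕ `DirSupSq37` ∕ `DirSup310` HOLD AT THE PINS BY SLICE RELABELLING: on n06-d's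
# site-sector coordinate carrier `XSK = sites × directions × κ × κ` a block contains every direction slice, so a two-space sup majorant of the
# bundled `∇_U ∘ T` (`T ∘ ∇*_U`) IS a majorant of every component `∇_{U,μ} ∘ T` (`T ∘ ∇*_{U,μ}`) for every SLICE-CONSTANT letter `T` — in particular for
# def-Y's `G′(U)` model `GcoS` at every configuration (no regularity needed)

T. Bałaban, *Propagators for lattice gauge theories in a background field*, Commun. Math. Phys. **99** (1985) 389–434
[`Balaban1985BackgroundPropagators`, "B9"]; [4] = T. Bałaban, *Propagators and renormalization transformations for lattice gauge
theories. II*, Commun. Math. Phys. **96** (1984) 223–250 [`Balaban1984PropagatorsII`].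

statement-level skeleton of published theorems with citation tags; proofs where landed; nothing here is a claim about the Yang–Mills
mass gap

THE PRINTED LOCI.  [B9] (3.39) p. 397: *"|A| = max_μ sup_x |A_μ(x)|"* — the sup norm of a vector-valued lattice function runs over the direction index, so
a bound of `∇_U f = (∇_{U,μ} f)_μ` is a bound of each component; (3.3)–(3.8) pp. 390–392 (`∇_{U,μ}`, `∇*_{U,μ}`); (3.42) p. 397 (the entries `∇_UG′(U)`,
`G′(U)∇*_U`); Cor. 3.6 p. 408 (the same for the cube operators `G′_□`); [4] (2.51) p. 232 (block majorants).

THE POINT (cell `pub-ymgap`, node N06; width seat w5, CLAIM-3, dag-n06-d's ANSWER ASK-NEXT 2026-08-28: «the `DirSupSq37 (𝔬 x) (𝔡 x) 1 (H x) U` inhabitant at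
the pins … S-sized, kinematic»).  The N06 certificate (ed. 27∕28, rows 18) DISPLAYS the conjunct `DirSup37 (𝔬 x) (𝔡 x) 1 (H x) U` of `h36H` (n06-k's transfer
schema, `B9RWSums346MixedPair`), and the pin owner's ruling R1′ re-types `h36` over n06-c's twin `DirSupSq37` (`B9Thm37WholeDir` §1, docstring: *"inhabited at
the pins by slice relabelling (a block of the carrier contains all slices)"*).  THIS FILE is that relabelling as kernel lemmas:
* §1 over n06-d's coordinate functor `coordOpK b` on any carrier `S × D × κ × κ` blocked through the FIRST coordinate only (`blk = fun p => s p.1`, slot-blind —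
  the pins `blkSK sI`): the slot swap `f ↦ (p ↦ f (p.1, swap μ ν p.2.1, p.2.2))` (inlined, no definition), `assembleK_swapSlot` (the re-assembled `μ`-slice of the swapped input is the `ν`-slice of the input),
  `blockSupp_swapSlot`; ★★ `hasMajorant_constSlice_of_family` — if `r • coordOpK b F` (the family `ν ↦ F ν` slice by slice) has the two-space majorant `m`, then for
  every `μ` the slice-CONSTANT model `r • coordOpK b (fun _ => F μ)` has the majorant `m` (evaluate the hypothesis at the swapped input and the swapped slot);
* §2 ★★ `dirSup37_of_pins` — `DirSup37 𝔬 𝔡 R H U₁` for ANY `B9Thm37Whole.Ops` record and direction letters pinned as the certificate pins them: `𝔬.blk = 𝔬.blkY = blkSK i sI`,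
  `𝔬.Gp U₁ = GcoS i b B cfg O U₁ = (η²·cR39 b) • coordOpK b (fun _ => O(U₁))` (SLICE-CONSTANT), `𝔬.D U₁ = DcoS … = η⁻¹ • coordOpK b (ν ↦ ∇_{U,ν})`, `𝔬.Dstar U₁ = DscoS …`,
  `𝔡.Dd U₁ μ = η⁻¹ • coordOpK b (fun _ => ∇_{U,μ})`, `𝔡.Dsd U₁ μ` likewise — EVERY `U₁`, no (3.35) regularity; ★★ `dirSupSq37_of_pins` — `DirSupSq37 𝔬 𝔡 R H U₁` under the same
  pins plus ONE pin-shape hypothesis on the cube operators, `hGsq : ∀ i, ∃ r G, 𝔬.Gsq U₁ i = r • coordOpK b (fun _ => G)` (slice-constant — the shape def-Y's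
  `opsWalkY` ∕ n06-d's FILE C-2 gives the genuine `G′_□`);
  ★★ `dirSup310_of_pins` — the bond-sector twin `DirSup310` (the displayed conjunct of `h36HA`) at the pins `GcoK ∕ DcoK ∕ DscoK` + `coordOpK b (fun _ => cdBₗ μ)`;
* §3 at def-Y's members: `dirSup37_pins` ∕ `dirSupSq37_pins` ∕ `dirSup310_pins` with the certificate's pins `hblkS ∕ hblkYS ∕ hGpS ∕ hDS ∕ hDsS ∕ h𝔡d ∕ h𝔡s` VERBATIM (`x : MemberY …`, `trBasis N`,
  `bg9Y … (specialUnitaryUnits (Fin N)) x`, `(fun U => U)`).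

HONEST SCOPE.  Pure relabelling algebra over n06-d's coordinate functor (`coordOpK_apply ∕ coordOpK_comp`); no estimate of [B9] is asserted (the majorants
`m` are hypotheses of the schemas' own fields); COUNT-NEUTRAL; N06 is NOT discharged; one finite lattice at a time; nothing continuum, nothing about
the mass gap ∕ Clay.  Cell `pub-ymgap` (HUMAN RULING D-0062 ∕ D-0154), Track A node N06 [B9], width seat `pub-ymgap-dag-n06-w5` (g0), 2026-08-28.
-/

noncomputable section

namespace Literature.MathematicalPhysics.QuantumFieldTheory.Balaban1983to89.B9DirSupAtPins

open B6KLevelCensusIndexV1 (KIdx)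
open B6RandomWalk (HasMajorant BlockSupp)
open B6RandomWalkHom (HasMajorantHom)
open B9Thm34Ext (toB6)
open B9Thm37Whole (Ops)
open B9RWSums346SecondDiffGp (DirOps37)
open B9RWSums346MixedPair (DirSup37 DirSup310)
open B9Thm310Whole (Ops310)
open B9RWSums346SecondDiff (DirOps310)
open B9Thm37WholeDir (DirSupSq37)
open B9Thm39ReadingCoords (cR39)
open B9GeoNormsKLevelV1 (geo9K)
open B9CoReadingCoords (assembleK coordOpK coordOpK_apply coordOpK_comp XBK blkBK GcoK DcoK DscoK cdBₗ cdsBₗ)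
open B9CoReadingCoordsS (XSK blkSK GcoS DcoS DscoS)
open B9Ineq349SiteComposite (cdSL cdsSL)
open Node00
open scoped Matrix

variable {d ℓ : ℕ} {hd : 1 ≤ d + 1} {hL : Odd (ℓ + 1) ∧ 1 < ℓ + 1} {b₀ b₁ : ℝ}

/-! ## §1 Slice relabelling on `S × D × κ × κ`: slot-blind blocks see every slice -/

section Relabel

variable {𝔸 : Type} [NormedRing 𝔸] [NormedAlgebra ℂ 𝔸] [FiniteDimensional ℝ 𝔸]
variable {κ : Type} [Fintype κ]
variable {S D : Type} [DecidableEq D] (b : Module.Basis κ ℝ 𝔸)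

omit [DecidableEq D] [FiniteDimensional ℝ 𝔸] in
/-- the slot swap `f ↦ (p ↦ f (p.1, swap μ ν p.2.1, p.2.2))` exchanges the `μ`- and `ν`-slices of a coordinate vector; the re-assembled `μ`-slice of the
swapped vector is the `ν`-slice of the original. [cite: Balaban1985BackgroundPropagators, (3.39) p.397, dictionary] -/
theorem assembleK_swapSlot [DecidableEq D] (μ ν : D) (c' : κ) (f : S × D × κ × κ → ℝ) :
    assembleK b μ c' (fun p : S × D × κ × κ => f (p.1, Equiv.swap μ ν p.2.1, p.2.2)) = assembleK b ν c' f := by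
  funext z
  show (∑ a, f ((z, μ, a, c').1, Equiv.swap μ ν (z, μ, a, c').2.1, (z, μ, a, c').2.2) • b a) = ∑ a, f (z, ν, a, c') • b a
  refine Finset.sum_congr rfl fun a _ => ?_
  simp only [Equiv.swap_apply_left]

omit [NormedAlgebra ℂ 𝔸] [FiniteDimensional ℝ 𝔸] [Fintype κ] in
/-- a slot-blind block support is invariant under the slot swap. [cite: Balaban1984PropagatorsII, (2.51) p.232 («supp λ ⊂ Δ(y′)»), dictionary] -/
theorem blockSupp_swapSlot {G : B6.Geometry} (s : S → G.Site) (μ ν : D) {f : S × D × κ × κ → ℝ} {y' : G.Site} {B : ℝ}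
    (hf : BlockSupp (fun p : S × D × κ × κ => s p.1) f y' B) :
    BlockSupp (fun p : S × D × κ × κ => s p.1) (fun p : S × D × κ × κ => f (p.1, Equiv.swap μ ν p.2.1, p.2.2)) y' B :=
  ⟨hf.nonneg, fun p hp => hf.bound (p.1, Equiv.swap μ ν p.2.1, p.2.2) hp, fun p hp => hf.off (p.1, Equiv.swap μ ν p.2.1, p.2.2) hp⟩

omit [FiniteDimensional ℝ 𝔸] in
/-- ★★ **SLICE RELABELLING**: over a carrier blocked through its first coordinate only, a two-space sup majorant `m` of the slice-by-slice model
`r • coordOpK b F` of a direction family `F` is, for every direction `μ`, a majorant of the slice-CONSTANT model `r • coordOpK b (fun _ => F μ)` — the value of the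
latter at `(z, ν, c, c′)` is the value of the former at the swapped input and the slot `(z, μ, c, c′)` of the same block (*"|A| = max_μ sup_x |A_μ(x)|"*).
[cite: Balaban1985BackgroundPropagators, (3.39) p.397 + (3.42) p.397; Balaban1984PropagatorsII, (2.51) p.232] -/
theorem hasMajorant_constSlice_of_family {G : B6.Geometry} (s : S → G.Site) (F : D → (S → 𝔸) →ₗ[ℝ] (S → 𝔸)) (r : ℝ)
    {m : G.Site → G.Site → ℝ}
    (h : HasMajorantHom (g := G) (fun p : S × D × κ × κ => s p.1) (fun p : S × D × κ × κ => s p.1) (r • coordOpK b F) m) (μ : D) :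
    HasMajorant (g := G) (fun p : S × D × κ × κ => s p.1) (r • coordOpK b (fun _ : D => F μ)) m := by
  intro y' f B hf p
  have hval : (r • coordOpK b (fun _ : D => F μ)) f p =
      (r • coordOpK b F) (fun q : S × D × κ × κ => f (q.1, Equiv.swap μ p.2.1 q.2.1, q.2.2)) (p.1, μ, p.2.2) := by
    simp only [LinearMap.smul_apply, Pi.smul_apply, smul_eq_mul, coordOpK_apply, assembleK_swapSlot]
  rw [hval]
  exact h y' _ B (blockSupp_swapSlot s μ p.2.1 hf) (p.1, μ, p.2.2)

omit [FiniteDimensional ℝ 𝔸] in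
/-- the two-space form of `hasMajorant_constSlice_of_family` (same block map on both sides). [cite: Balaban1985BackgroundPropagators, (3.39) p.397; Balaban1984PropagatorsII, (2.51) p.232] -/
theorem hasMajorantHom_constSlice_of_family {G : B6.Geometry} (s : S → G.Site) (F : D → (S → 𝔸) →ₗ[ℝ] (S → 𝔸)) (r : ℝ)
    {m : G.Site → G.Site → ℝ}
    (h : HasMajorantHom (g := G) (fun p : S × D × κ × κ => s p.1) (fun p : S × D × κ × κ => s p.1) (r • coordOpK b F) m) (μ : D) :
    HasMajorantHom (g := G) (fun p : S × D × κ × κ => s p.1) (fun p : S × D × κ × κ => s p.1) (r • coordOpK b (fun _ : D => F μ)) m :=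
  (B6RandomWalkHom.hasMajorantHom_iff _ _ _).2 (hasMajorant_constSlice_of_family b s F r h μ)

omit [DecidableEq D] [FiniteDimensional ℝ 𝔸] in
/-- the composite of a slice-by-slice model with a slice-constant one, scalars collected (n06-d's functoriality `coordOpK_comp`).
[cite: Balaban1985BackgroundPropagators, (3.42) p.397, dictionary] -/
theorem smul_coordOpK_comp_smul_coordOpK (r r' : ℝ) (F F' : D → (S → 𝔸) →ₗ[ℝ] (S → 𝔸)) :
    (r • coordOpK b F) ∘ₗ (r' • coordOpK b F') = (r * r') • coordOpK b (fun ν => F ν ∘ₗ F' ν) := by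
  rw [LinearMap.smul_comp, LinearMap.comp_smul, smul_smul, coordOpK_comp]

end Relabel

/-! ## §2 The transfer schemas at n06-d's site-sector pins, every configuration -/

section Pins

variable {𝔸 : Type} [NormedRing 𝔸] [NormedAlgebra ℂ 𝔸] [CompleteSpace 𝔸] [FiniteDimensional ℝ 𝔸]
variable {κ : Type} [Fintype κ]
variable (i : KIdx d ℓ hd hL b₀ b₁) (b : Module.Basis κ ℝ 𝔸) (B : B9.Backgrounds) (cfg : B.Cfg → CfgY 𝔸 i) (O : SiteOpY 𝔸 i)
variable {ι : Type} [Fintype (geo9K i).Site]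

/-- ★★ **`DirSup37` AT THE PINS, EVERY CONFIGURATION** (the displayed conjunct of the N06 certificate's `h36H`): for any Theorem-3.7 letter record over n06-d's
site carrier `XSK` whose block maps are the slot-blind `blkSK i sI` and whose `G′ ∕ ∇_U ∕ ∇*_U` at `U₁` are def-Y's models `GcoS ∕ DcoS ∕ DscoS`, and direction letters
pinned to `η⁻¹ • coordOpK b (fun _ => ∇_{U,μ})` ∕ `(… ∇*_{U,μ})`, the bundled entries transfer to every direction: `G′` is slice-constant, so `∇_{U,μ}G′` on the
`ν`-slice is `∇_UG′` on the `μ`-slice of the swapped input. [cite: Balaban1985BackgroundPropagators, (3.39) p.397 + (3.42) p.397 + (3.3)–(3.8) pp.390–392; Balaban1984PropagatorsII, (2.51) p.232] -/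
theorem dirSup37_of_pins (𝔬 : Ops (geo9K i) B (XSK κ i) (XSK κ i) ι) (𝔡 : DirOps37 𝔬 (Fin (d + 1))) {sI : SiteY i → IBondY i}
    (hblk : 𝔬.blk = blkSK i sI) (hblkY : 𝔬.blkY = blkSK i sI) {U₁ : B.Cfg} (hGp : 𝔬.Gp U₁ = GcoS i b B cfg O U₁)
    (hD : 𝔬.D U₁ = DcoS i b B cfg U₁) (hDs : 𝔬.Dstar U₁ = DscoS i b B cfg U₁)
    (hDd : 𝔡.Dd U₁ = fun μ => (etaS i)⁻¹ • coordOpK b (fun _ : Fin (d + 1) => (cdSL i (cfg U₁) μ).restrictScalars ℝ))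
    (hDsd : 𝔡.Dsd U₁ = fun μ => (etaS i)⁻¹ • coordOpK b (fun _ : Fin (d + 1) => (cdsSL i (cfg U₁) μ).restrictScalars ℝ))
    {R : ℝ} {H : Prop} : DirSup37 𝔬 𝔡 R H U₁ := by
  refine ⟨fun m hm ν => ?_, fun m hm μ => ?_⟩
  · -- left: ∇_{U,ν} ∘ G′ is the slice-constant model of the family μ ↦ ∇_{U,μ} ∘ O at the slot ν
    rw [hblk, hblkY, hD, hGp] at hm
    rw [hblk, hDd, hGp]
    change HasMajorantHom (g := toB6 (geo9K i) R H) (fun p : XSK κ i => sI p.1) (fun p : XSK κ i => sI p.1)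
      (((etaS i)⁻¹ • coordOpK b (fun _ : Fin (d + 1) => (cdSL i (cfg U₁) ν).restrictScalars ℝ)) ∘ₗ
        ((etaS i ^ 2 * cR39 b) • coordOpK b (fun _ : Fin (d + 1) => (O (cfg U₁)).restrictScalars ℝ))) m
    change HasMajorantHom (g := toB6 (geo9K i) R H) (fun p : XSK κ i => sI p.1) (fun p : XSK κ i => sI p.1)
      (((etaS i)⁻¹ • coordOpK b (fun μ : Fin (d + 1) => (cdSL i (cfg U₁) μ).restrictScalars ℝ)) ∘ₗ
        ((etaS i ^ 2 * cR39 b) • coordOpK b (fun _ : Fin (d + 1) => (O (cfg U₁)).restrictScalars ℝ))) m at hm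
    rw [smul_coordOpK_comp_smul_coordOpK] at hm ⊢
    exact hasMajorantHom_constSlice_of_family b (G := toB6 (geo9K i) R H) sI
      (fun μ : Fin (d + 1) => (cdSL i (cfg U₁) μ).restrictScalars ℝ ∘ₗ (O (cfg U₁)).restrictScalars ℝ) _ hm ν
  · -- right: G′ ∘ ∇*_{U,μ} likewise
    rw [hblk, hblkY, hDs, hGp] at hm
    rw [hblk, hDsd, hGp]
    change HasMajorantHom (g := toB6 (geo9K i) R H) (fun p : XSK κ i => sI p.1) (fun p : XSK κ i => sI p.1)
      (((etaS i ^ 2 * cR39 b) • coordOpK b (fun _ : Fin (d + 1) => (O (cfg U₁)).restrictScalars ℝ)) ∘ₗ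
        ((etaS i)⁻¹ • coordOpK b (fun _ : Fin (d + 1) => (cdsSL i (cfg U₁) μ).restrictScalars ℝ))) m
    change HasMajorantHom (g := toB6 (geo9K i) R H) (fun p : XSK κ i => sI p.1) (fun p : XSK κ i => sI p.1)
      (((etaS i ^ 2 * cR39 b) • coordOpK b (fun _ : Fin (d + 1) => (O (cfg U₁)).restrictScalars ℝ)) ∘ₗ
        ((etaS i)⁻¹ • coordOpK b (fun ν : Fin (d + 1) => (cdsSL i (cfg U₁) ν).restrictScalars ℝ))) m at hm
    rw [smul_coordOpK_comp_smul_coordOpK] at hm ⊢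
    exact hasMajorantHom_constSlice_of_family b (G := toB6 (geo9K i) R H) sI
      (fun ν : Fin (d + 1) => (O (cfg U₁)).restrictScalars ℝ ∘ₗ (cdsSL i (cfg U₁) ν).restrictScalars ℝ) _ hm μ

omit [FiniteDimensional ℝ 𝔸] in
/-- ★★ **`DirSupSq37` AT THE PINS, EVERY CONFIGURATION, FOR SLICE-CONSTANT CUBE OPERATORS** (n06-c's `Gsq`-twin, the conjunct of the re-typed `h36` under the pin
owner's ruling R1′): with the same pins and the ONE shape hypothesis `hGsq : ∀ □, ∃ r G, 𝔬.Gsq U₁ □ = r • coordOpK b (fun _ => G)` (the cube operators `G′_□` read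
slice by slice by one site operator — the shape of def-Y's walk-letter instance), the entries `∇_U ∘ G′_□`, `G′_□ ∘ ∇*_U` transfer to every direction.
[cite: Balaban1985BackgroundPropagators, Cor. 3.6 p.408 + (3.39) p.397 + (3.42) p.397; Balaban1984PropagatorsII, (2.51) p.232] -/
theorem dirSupSq37_of_pins (𝔬 : Ops (geo9K i) B (XSK κ i) (XSK κ i) ι) (𝔡 : DirOps37 𝔬 (Fin (d + 1))) {sI : SiteY i → IBondY i}
    (hblk : 𝔬.blk = blkSK i sI) (hblkY : 𝔬.blkY = blkSK i sI) {U₁ : B.Cfg}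
    (hD : 𝔬.D U₁ = DcoS i b B cfg U₁) (hDs : 𝔬.Dstar U₁ = DscoS i b B cfg U₁)
    (hDd : 𝔡.Dd U₁ = fun μ => (etaS i)⁻¹ • coordOpK b (fun _ : Fin (d + 1) => (cdSL i (cfg U₁) μ).restrictScalars ℝ))
    (hDsd : 𝔡.Dsd U₁ = fun μ => (etaS i)⁻¹ • coordOpK b (fun _ : Fin (d + 1) => (cdsSL i (cfg U₁) μ).restrictScalars ℝ))
    (hGsq : ∀ j : ι, ∃ (r : ℝ) (G : (SiteY i → 𝔸) →ₗ[ℝ] (SiteY i → 𝔸)), 𝔬.Gsq U₁ j = r • coordOpK b (fun _ : Fin (d + 1) => G))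
    {R : ℝ} {H : Prop} : DirSupSq37 𝔬 𝔡 R H U₁ := by
  refine ⟨fun j m hm ν => ?_, fun j m hm μ => ?_⟩
  · obtain ⟨r, G, hG⟩ := hGsq j
    rw [hblk, hblkY, hD, hG] at hm
    rw [hblk, hDd, hG]
    change HasMajorant (g := toB6 (geo9K i) R H) (fun p : XSK κ i => sI p.1)
      (((etaS i)⁻¹ • coordOpK b (fun _ : Fin (d + 1) => (cdSL i (cfg U₁) ν).restrictScalars ℝ)) ∘ₗ (r • coordOpK b (fun _ : Fin (d + 1) => G))) m
    change HasMajorantHom (g := toB6 (geo9K i) R H) (fun p : XSK κ i => sI p.1) (fun p : XSK κ i => sI p.1)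
      (((etaS i)⁻¹ • coordOpK b (fun μ : Fin (d + 1) => (cdSL i (cfg U₁) μ).restrictScalars ℝ)) ∘ₗ (r • coordOpK b (fun _ : Fin (d + 1) => G))) m at hm
    rw [smul_coordOpK_comp_smul_coordOpK] at hm ⊢
    exact hasMajorant_constSlice_of_family b (G := toB6 (geo9K i) R H) sI
      (fun μ : Fin (d + 1) => (cdSL i (cfg U₁) μ).restrictScalars ℝ ∘ₗ G) _ hm ν
  · obtain ⟨r, G, hG⟩ := hGsq j
    rw [hblk, hblkY, hDs, hG] at hm
    rw [hblk, hDsd, hG]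
    change HasMajorant (g := toB6 (geo9K i) R H) (fun p : XSK κ i => sI p.1)
      ((r • coordOpK b (fun _ : Fin (d + 1) => G)) ∘ₗ ((etaS i)⁻¹ • coordOpK b (fun _ : Fin (d + 1) => (cdsSL i (cfg U₁) μ).restrictScalars ℝ))) m
    change HasMajorantHom (g := toB6 (geo9K i) R H) (fun p : XSK κ i => sI p.1) (fun p : XSK κ i => sI p.1)
      ((r • coordOpK b (fun _ : Fin (d + 1) => G)) ∘ₗ ((etaS i)⁻¹ • coordOpK b (fun ν : Fin (d + 1) => (cdsSL i (cfg U₁) ν).restrictScalars ℝ))) m at hm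
    rw [smul_coordOpK_comp_smul_coordOpK] at hm ⊢
    exact hasMajorant_constSlice_of_family b (G := toB6 (geo9K i) R H) sI
      (fun ν : Fin (d + 1) => G ∘ₗ (cdsSL i (cfg U₁) ν).restrictScalars ℝ) _ hm μ

/-- ★★ **`DirSup310` AT THE BOND-SECTOR PINS, EVERY CONFIGURATION** (the displayed conjunct of the N06 certificate's `h36HA`): for any Theorem-3.10 letter record over
n06-d's bond carrier `XBK` whose block maps are the slot-blind `blkBK i bI` and whose `G ∕ ∇_U ∕ ∇*_U` at `U₁` are def-Y's models `GcoK ∕ DcoK ∕ DscoK`, and direction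
letters pinned to `coordOpK b (fun _ => ∇_{U,μ})` ∕ `(… ∇*_{U,μ})` (the certificate's `hGcoA ∕ hDcoA ∕ hDscoA ∕ h𝔡Ad ∕ h𝔡As ∕ hblkA ∕ hblkYA`), the bundled entries transfer to
every direction — `G(U)`'s model is slice-constant. [cite: Balaban1985BackgroundPropagators, (3.39) p.397 + (3.42) p.397 + Thm 3.10 p.416; Balaban1984PropagatorsII, (2.51) p.232] -/
theorem dirSup310_of_pins {A : Type} (OA : BondOpY 𝔸 i) (𝔬 : Ops310 (geo9K i) B (XBK κ i) (XBK κ i) ι A) (𝔡 : DirOps310 𝔬 (Fin (d + 1)))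
    {bI : FBondY i → IBondY i} (hblk : 𝔬.blk = blkBK i bI) (hblkY : 𝔬.blkY = blkBK i bI) {U₁ : B.Cfg}
    (hG : 𝔬.G U₁ = GcoK i b B cfg OA U₁) (hD : 𝔬.D U₁ = DcoK i b B cfg U₁) (hDs : 𝔬.Dstar U₁ = DscoK i b B cfg U₁)
    (hDd : 𝔡.Dd U₁ = fun μ => coordOpK b (fun _ : Fin (d + 1) => cdBₗ i (cfg U₁) μ))
    (hDsd : 𝔡.Dsd U₁ = fun μ => coordOpK b (fun _ : Fin (d + 1) => cdsBₗ i (cfg U₁) μ))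
    {R : ℝ} {H : Prop} : DirSup310 𝔬 𝔡 R H U₁ := by
  refine ⟨fun m hm ν => ?_, fun m hm μ => ?_⟩
  · rw [hblk, hblkY, hD, hG] at hm
    rw [hblk, hDd, hG]
    change HasMajorantHom (g := toB6 (geo9K i) R H) (fun p : XBK κ i => bI p.1) (fun p : XBK κ i => bI p.1)
      ((coordOpK b (fun _ : Fin (d + 1) => cdBₗ i (cfg U₁) ν)) ∘ₗ
        ((cR39 b) • coordOpK b (fun _ : Fin (d + 1) => (OA (cfg U₁)).restrictScalars ℝ))) m
    change HasMajorantHom (g := toB6 (geo9K i) R H) (fun p : XBK κ i => bI p.1) (fun p : XBK κ i => bI p.1)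
      ((coordOpK b (fun μ : Fin (d + 1) => cdBₗ i (cfg U₁) μ)) ∘ₗ
        ((cR39 b) • coordOpK b (fun _ : Fin (d + 1) => (OA (cfg U₁)).restrictScalars ℝ))) m at hm
    rw [← one_smul ℝ (coordOpK b (fun _ : Fin (d + 1) => cdBₗ i (cfg U₁) ν)), smul_coordOpK_comp_smul_coordOpK]
    rw [← one_smul ℝ (coordOpK b (fun μ : Fin (d + 1) => cdBₗ i (cfg U₁) μ)), smul_coordOpK_comp_smul_coordOpK] at hm
    exact hasMajorantHom_constSlice_of_family b (G := toB6 (geo9K i) R H) bI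
      (fun μ : Fin (d + 1) => cdBₗ i (cfg U₁) μ ∘ₗ (OA (cfg U₁)).restrictScalars ℝ) _ hm ν
  · rw [hblk, hblkY, hDs, hG] at hm
    rw [hblk, hDsd, hG]
    change HasMajorantHom (g := toB6 (geo9K i) R H) (fun p : XBK κ i => bI p.1) (fun p : XBK κ i => bI p.1)
      (((cR39 b) • coordOpK b (fun _ : Fin (d + 1) => (OA (cfg U₁)).restrictScalars ℝ)) ∘ₗ
        (coordOpK b (fun _ : Fin (d + 1) => cdsBₗ i (cfg U₁) μ))) m
    change HasMajorantHom (g := toB6 (geo9K i) R H) (fun p : XBK κ i => bI p.1) (fun p : XBK κ i => bI p.1)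
      (((cR39 b) • coordOpK b (fun _ : Fin (d + 1) => (OA (cfg U₁)).restrictScalars ℝ)) ∘ₗ
        (coordOpK b (fun ν : Fin (d + 1) => cdsBₗ i (cfg U₁) ν))) m at hm
    rw [← one_smul ℝ (coordOpK b (fun _ : Fin (d + 1) => cdsBₗ i (cfg U₁) μ)), smul_coordOpK_comp_smul_coordOpK]
    rw [← one_smul ℝ (coordOpK b (fun ν : Fin (d + 1) => cdsBₗ i (cfg U₁) ν)), smul_coordOpK_comp_smul_coordOpK] at hm
    exact hasMajorantHom_constSlice_of_family b (G := toB6 (geo9K i) R H) bI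
      (fun ν : Fin (d + 1) => (OA (cfg U₁)).restrictScalars ℝ ∘ₗ cdsBₗ i (cfg U₁) ν) _ hm μ

end Pins

/-! ## §3 At node00-def-Y's members, with the certificate's pins verbatim -/

section Members

open scoped Matrix.Norms.L2Operator
open B7Prop2SpecialUnitary (specialUnitaryUnits)
open B9PinMembersKLevelV1 (MemberY geo9Y bg9Y)
open B9CoReadingCoordsTranspose (TrIdx trBasis)
open B9CoReadingCoordsS (sIK)

variable {Mstar : ℕ} {N : ℕ}
variable [∀ x : MemberY d ℓ hd hL b₀ b₁ Mstar, Fintype (geo9Y x).Site]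

/-- ★★ **`DirSup37 (𝔬 x) (𝔡 x) R H U` AT THE CERTIFICATE'S PINS, EVERY MEMBER, EVERY `U`** (pins `hblkS ∕ hblkYS ∕ hGpS ∕ hDS ∕ hDsS ∕ h𝔡d ∕ h𝔡s` of editions ≥ 17 verbatim;
`Gp` = any site letter, e.g. `(lettersYOfRecordV4P …).Gp`): the displayed conjunct of `h36H` is a theorem of the pins.
[cite: Balaban1985BackgroundPropagators, (3.39) p.397 + (3.42) p.397 + (3.3)–(3.8) pp.390–392; Balaban1984PropagatorsII, (2.51) p.232] -/
theorem dirSup37_pins (x : MemberY d ℓ hd hL b₀ b₁ Mstar) {ι : Type}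
    (𝔬 : Ops (geo9Y x) (bg9Y (Matrix (Fin N) (Fin N) ℂ) (specialUnitaryUnits (Fin N)) x) (XSK (TrIdx N) x.toKIdx) (XSK (TrIdx N) x.toKIdx) ι)
    (𝔡 : DirOps37 𝔬 (Fin (d + 1))) {bI : FBondY x.toKIdx → IBondY x.toKIdx} (Gp : SiteOpY (Matrix (Fin N) (Fin N) ℂ) x.toKIdx)
    (hblkS : 𝔬.blk = blkSK x.toKIdx (sIK x.toKIdx bI)) (hblkYS : 𝔬.blkY = blkSK x.toKIdx (sIK x.toKIdx bI))
    {U : (bg9Y (Matrix (Fin N) (Fin N) ℂ) (specialUnitaryUnits (Fin N)) x).Cfg}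
    (hGpS : 𝔬.Gp U = GcoS x.toKIdx (trBasis N) (bg9Y (Matrix (Fin N) (Fin N) ℂ) (specialUnitaryUnits (Fin N)) x) (fun U => U) Gp U)
    (hDS : 𝔬.D U = DcoS x.toKIdx (trBasis N) (bg9Y (Matrix (Fin N) (Fin N) ℂ) (specialUnitaryUnits (Fin N)) x) (fun U => U) U)
    (hDsS : 𝔬.Dstar U = DscoS x.toKIdx (trBasis N) (bg9Y (Matrix (Fin N) (Fin N) ℂ) (specialUnitaryUnits (Fin N)) x) (fun U => U) U)
    (h𝔡d : 𝔡.Dd U = fun μ => (etaS x.toKIdx)⁻¹ • coordOpK (trBasis N) (fun _ : Fin (d + 1) => (cdSL x.toKIdx U μ).restrictScalars ℝ))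
    (h𝔡s : 𝔡.Dsd U = fun μ => (etaS x.toKIdx)⁻¹ • coordOpK (trBasis N) (fun _ : Fin (d + 1) => (cdsSL x.toKIdx U μ).restrictScalars ℝ))
    {R : ℝ} {H : Prop} : DirSup37 𝔬 𝔡 R H U := by
  letI : Fintype (geo9K x.toKIdx).Site := (inferInstance : Fintype (geo9Y x).Site)
  exact dirSup37_of_pins x.toKIdx (trBasis N) (bg9Y (Matrix (Fin N) (Fin N) ℂ) (specialUnitaryUnits (Fin N)) x) (fun U => U) Gp 𝔬 𝔡
    hblkS hblkYS hGpS hDS hDsS h𝔡d h𝔡s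

/-- ★★ **`DirSupSq37 (𝔬 x) (𝔡 x) R H U` AT THE CERTIFICATE'S PINS, EVERY MEMBER, EVERY `U`, FOR SLICE-CONSTANT CUBE OPERATORS** (the conjunct of the re-typed
`h36` under R1′; `hGsq` = the shape of the walk-letter instance's `G′_□`). [cite: Balaban1985BackgroundPropagators, Cor. 3.6 p.408 + (3.39) p.397 + (3.42) p.397; Balaban1984PropagatorsII, (2.51) p.232] -/
theorem dirSupSq37_pins (x : MemberY d ℓ hd hL b₀ b₁ Mstar) {ι : Type}
    (𝔬 : Ops (geo9Y x) (bg9Y (Matrix (Fin N) (Fin N) ℂ) (specialUnitaryUnits (Fin N)) x) (XSK (TrIdx N) x.toKIdx) (XSK (TrIdx N) x.toKIdx) ι)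
    (𝔡 : DirOps37 𝔬 (Fin (d + 1))) {bI : FBondY x.toKIdx → IBondY x.toKIdx}
    (hblkS : 𝔬.blk = blkSK x.toKIdx (sIK x.toKIdx bI)) (hblkYS : 𝔬.blkY = blkSK x.toKIdx (sIK x.toKIdx bI))
    {U : (bg9Y (Matrix (Fin N) (Fin N) ℂ) (specialUnitaryUnits (Fin N)) x).Cfg}
    (hDS : 𝔬.D U = DcoS x.toKIdx (trBasis N) (bg9Y (Matrix (Fin N) (Fin N) ℂ) (specialUnitaryUnits (Fin N)) x) (fun U => U) U)
    (hDsS : 𝔬.Dstar U = DscoS x.toKIdx (trBasis N) (bg9Y (Matrix (Fin N) (Fin N) ℂ) (specialUnitaryUnits (Fin N)) x) (fun U => U) U)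
    (h𝔡d : 𝔡.Dd U = fun μ => (etaS x.toKIdx)⁻¹ • coordOpK (trBasis N) (fun _ : Fin (d + 1) => (cdSL x.toKIdx U μ).restrictScalars ℝ))
    (h𝔡s : 𝔡.Dsd U = fun μ => (etaS x.toKIdx)⁻¹ • coordOpK (trBasis N) (fun _ : Fin (d + 1) => (cdsSL x.toKIdx U μ).restrictScalars ℝ))
    (hGsq : ∀ j : ι, ∃ (r : ℝ) (G : (SiteY x.toKIdx → Matrix (Fin N) (Fin N) ℂ) →ₗ[ℝ] (SiteY x.toKIdx → Matrix (Fin N) (Fin N) ℂ)),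
      𝔬.Gsq U j = r • coordOpK (trBasis N) (fun _ : Fin (d + 1) => G))
    {R : ℝ} {H : Prop} : DirSupSq37 𝔬 𝔡 R H U := by
  letI : Fintype (geo9K x.toKIdx).Site := (inferInstance : Fintype (geo9Y x).Site)
  exact dirSupSq37_of_pins x.toKIdx (trBasis N) (bg9Y (Matrix (Fin N) (Fin N) ℂ) (specialUnitaryUnits (Fin N)) x) (fun U => U) 𝔬 𝔡
    hblkS hblkYS hDS hDsS h𝔡d h𝔡s hGsq

/-- ★★ **`DirSup310 (𝔬A x) (𝔡A x) R H U` AT THE CERTIFICATE'S BOND-SECTOR PINS, EVERY MEMBER, EVERY `U`** (pins `hblkA ∕ hblkYA ∕ hGcoA ∕ hDcoA ∕ hDscoA ∕ h𝔡Ad ∕ h𝔡As`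
verbatim; `GA` = any bond letter, e.g. `(lettersYOfRecordV4P …).GA`): the displayed conjunct of `h36HA` is a theorem of the pins.
[cite: Balaban1985BackgroundPropagators, (3.39) p.397 + (3.42) p.397 + Thm 3.10 p.416; Balaban1984PropagatorsII, (2.51) p.232] -/
theorem dirSup310_pins (x : MemberY d ℓ hd hL b₀ b₁ Mstar) {ι A : Type}
    (𝔬 : Ops310 (geo9Y x) (bg9Y (Matrix (Fin N) (Fin N) ℂ) (specialUnitaryUnits (Fin N)) x) (XBK (TrIdx N) x.toKIdx) (XBK (TrIdx N) x.toKIdx) ι A)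
    (𝔡 : DirOps310 𝔬 (Fin (d + 1))) {bI : FBondY x.toKIdx → IBondY x.toKIdx} (GA : BondOpY (Matrix (Fin N) (Fin N) ℂ) x.toKIdx)
    (hblkA : 𝔬.blk = blkBK x.toKIdx bI) (hblkYA : 𝔬.blkY = blkBK x.toKIdx bI)
    {U : (bg9Y (Matrix (Fin N) (Fin N) ℂ) (specialUnitaryUnits (Fin N)) x).Cfg}
    (hGcoA : 𝔬.G U = GcoK x.toKIdx (trBasis N) (bg9Y (Matrix (Fin N) (Fin N) ℂ) (specialUnitaryUnits (Fin N)) x) (fun U => U) GA U)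
    (hDcoA : 𝔬.D U = DcoK x.toKIdx (trBasis N) (bg9Y (Matrix (Fin N) (Fin N) ℂ) (specialUnitaryUnits (Fin N)) x) (fun U => U) U)
    (hDscoA : 𝔬.Dstar U = DscoK x.toKIdx (trBasis N) (bg9Y (Matrix (Fin N) (Fin N) ℂ) (specialUnitaryUnits (Fin N)) x) (fun U => U) U)
    (h𝔡Ad : 𝔡.Dd U = fun μ => coordOpK (trBasis N) (fun _ : Fin (d + 1) => cdBₗ x.toKIdx U μ))
    (h𝔡As : 𝔡.Dsd U = fun μ => coordOpK (trBasis N) (fun _ : Fin (d + 1) => cdsBₗ x.toKIdx U μ))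
    {R : ℝ} {H : Prop} : DirSup310 𝔬 𝔡 R H U := by
  letI : Fintype (geo9K x.toKIdx).Site := (inferInstance : Fintype (geo9Y x).Site)
  exact dirSup310_of_pins x.toKIdx (trBasis N) (bg9Y (Matrix (Fin N) (Fin N) ℂ) (specialUnitaryUnits (Fin N)) x) (fun U => U) GA 𝔬 𝔡
    hblkA hblkYA hGcoA hDcoA hDscoA h𝔡Ad h𝔡As

end Members

end Literature.MathematicalPhysics.QuantumFieldTheory.Balaban1983to89.B9DirSupAtPins

end
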